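import Summits.HubbardSuperconductivity.HubbardSuperconductivity.Theorems.BalabanIRBirEveryGroundStateClosures

/-!
# Route `LogColdTorus`, crux `AverageToEvery` (item `stmt-HubbardSuperconductivity-10519`),
# line `birth`: Schur on the joint commutant (`stub_schurScalarOnGround`)

Helper (`--supports`) for the crux
`Summit.HubbardSuperconductivity.HubbardSuperconductivity.Theses.LogColdTorus.AverageToEvery`
(shared with route `AbelianDuality`), line `birth`, stub `stub_schurScalarOnGround`.

**Statement.** At any coupling `U`, any side `L` and any particle number `N`: if the sector ground
eigenspace `E₀ = szSector N 0 ⊓ ker (H - e₀)` (`e₀ = minEnergyOn H (szSector N 0)`)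
of `H = hubbardTorus 2 L 1 U` has no subspace other than `⊥` and itself invariant under every
matrix commuting with `H`, `N̂`, `S^z` and `Y = Δ_d† Δ_d`, then `Y` has scalar matrix elements on
`E₀`: `⟨w, Y v⟩ = μ ⟨w, v⟩` for all `v, w ∈ E₀`.

**Proof.** The joint commutant preserves `E₀` (`mulVec_mem_groundEigenspace_of_commute`), is closed
under `ᴴ` (`conjTranspose_mem_symmetries`, all four matrices are Hermitian) and commutes with `Y`,
so Schur's lemma for the compression `P Y P` (`exists_scalar_matrixElements_of_irreducible`)
applies. This is exactly the Schur block of the landed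
`birEveryGroundState_of_irreducibleGround` (sibling crux `BirEveryGroundState`).
Serre, *Linear Representations of Finite Groups* §2.2; Tasaki (2020) §9.3. Folklore; no
definition and no named fact is introduced.
-/

noncomputable section

-- `dupNamespace`: the summit and the problem are both named `HubbardSuperconductivity` (layout D-0022)
set_option linter.dupNamespace false

namespace Summit.HubbardSuperconductivity.HubbardSuperconductivity.Theorems

open Matrix Finset
open Literature.Probability.LatticeModels Literature.MathematicalPhysics.QuantumLattice
open scoped ComplexOrder

/-- **Schur on the joint commutant** (stub `stub_schurScalarOnGround` of line `birth` of the crux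
`LogColdTorus.AverageToEvery`). At any coupling `U`, any side `L` and any particle number `N`: if the
sector ground eigenspace `E₀ = szSector N 0 ⊓ ker (H - e₀)` of `H = hubbardTorus 2 L 1 U` is
irreducible under the matrices commuting with `H`, `N̂`, `S^z` and `Y = Δ_d† Δ_d`, then `Y` has
scalar matrix elements on `E₀`: `⟨w, Y v⟩ = μ ⟨w, v⟩` for all `v, w ∈ E₀` (the
commutant preserves `E₀`, is `ᴴ`-closed and commutes with `Y`; Schur for the compression `P Y P`).
Serre, *Linear Representations of Finite Groups* §2.2; Tasaki (2020) §9.3. [folklore] -/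
theorem stub_schurScalarOnGround :
    ∀ (U : ℝ) (L N : ℕ) [NeZero L],
      (∀ K' : Submodule ℂ (Fock (Orb (FermionTorus 2 L))),
        K' ≤ szSector N 0 ⊓
          Module.End.eigenspace (Matrix.toLin' (hubbardTorus 2 L 1 U))
            ((((hubbardTorus 2 L 1 U).minEnergyOn (szSector N 0) : ℝ) : ℂ)) →
        (∀ X : Matrix (Finset (Orb (FermionTorus 2 L))) (Finset (Orb (FermionTorus 2 L))) ℂ,
          X * hubbardTorus 2 L 1 U = hubbardTorus 2 L 1 U * X →
          X * totalNumber = totalNumber * X →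
          X * HubbardWave0.spinZ = HubbardWave0.spinZ * X →
          X * ((pairField dWaveFormFactor L)ᴴ * pairField dWaveFormFactor L) =
            (pairField dWaveFormFactor L)ᴴ * pairField dWaveFormFactor L * X →
          ∀ v ∈ K', X *ᵥ v ∈ K') →
        K' = ⊥ ∨
          K' = szSector N 0 ⊓
            Module.End.eigenspace (Matrix.toLin' (hubbardTorus 2 L 1 U))
              ((((hubbardTorus 2 L 1 U).minEnergyOn (szSector N 0) : ℝ) : ℂ))) →
      ∃ μ : ℂ,
        ∀ v ∈ szSector N 0 ⊓
            Module.End.eigenspace (Matrix.toLin' (hubbardTorus 2 L 1 U))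
              ((((hubbardTorus 2 L 1 U).minEnergyOn (szSector N 0) : ℝ) : ℂ)),
          ∀ w ∈ szSector N 0 ⊓
              Module.End.eigenspace (Matrix.toLin' (hubbardTorus 2 L 1 U))
                ((((hubbardTorus 2 L 1 U).minEnergyOn (szSector N 0) : ℝ) : ℂ)),
            star w ⬝ᵥ ((pairField dWaveFormFactor L)ᴴ * pairField dWaveFormFactor L) *ᵥ v =
              μ * (star w ⬝ᵥ v) := by
  intro U L N _ hirrL
  -- name the objects of side `L`
  set Y : Matrix (Finset (Orb (FermionTorus 2 L))) (Finset (Orb (FermionTorus 2 L))) ℂ :=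
    (pairField dWaveFormFactor L)ᴴ * pairField dWaveFormFactor L with hY
  set H := hubbardTorus 2 L 1 U with hH
  set Sec := szSector (Λ := FermionTorus 2 L) N 0 with hSec
  set E₀ := Sec ⊓ Module.End.eigenspace (Matrix.toLin' H) ((H.minEnergyOn Sec : ℝ) : ℂ) with hE₀
  -- the joint commutant
  let Sym : Set (Matrix (Finset (Orb (FermionTorus 2 L))) (Finset (Orb (FermionTorus 2 L))) ℂ) :=
    {X | X * H = H * X ∧ X * totalNumber = totalNumber * X ∧
      X * HubbardWave0.spinZ = HubbardWave0.spinZ * X ∧ X * Y = Y * X}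
  have hSA : ∀ X ∈ Sym, X * Y = Y * X := fun X hX => hX.2.2.2
  have hSK : ∀ X ∈ Sym, ∀ v ∈ E₀, X *ᵥ v ∈ E₀ := fun X hX v hv =>
    mulVec_mem_groundEigenspace_of_commute L H X _ 0 hX.1 hX.2.1 hX.2.2.1 hv
  have hSK' : ∀ X ∈ Sym, ∀ v ∈ E₀, Xᴴ *ᵥ v ∈ E₀ := by
    intro X hX v hv
    obtain ⟨h1, h2, h3, -⟩ := conjTranspose_mem_symmetries L 1 U dWaveFormFactor
      hX.1 hX.2.1 hX.2.2.1 hX.2.2.2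
    exact mulVec_mem_groundEigenspace_of_commute L H Xᴴ _ 0 h1 h2 h3 hv
  have hirr' : ∀ K' : Submodule ℂ (Fock (Orb (FermionTorus 2 L))), K' ≤ E₀ →
      (∀ X ∈ Sym, ∀ v ∈ K', X *ᵥ v ∈ K') → K' = ⊥ ∨ K' = E₀ := fun K' hK' hinv =>
    hirrL K' hK' fun X h1 h2 h3 h4 v hv => hinv X ⟨h1, h2, h3, h4⟩ v hv
  exact exists_scalar_matrixElements_of_irreducible E₀ Y Sym hSA hSK hSK' hirr'

end Summit.HubbardSuperconductivity.HubbardSuperconductivity.Theorems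

end
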